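import Literature.AlgebraicGeometry.ShimuraVarieties.UnitaryCurveConePullbackInjective
import Literature.AlgebraicGeometry.ShimuraVarieties.UnitaryConeDiscontinuity
import Literature.AlgebraicGeometry.HodgeTheory.OneZeroFormOfClass
import Literature.NumberTheory.Automorphic.UnitaryGroupArchSection
import HarnessLib

/-!
# A degree-one class of a compact unitary Shimura CURVE is detected by the cone reads of its `(1,0)`-form and of the
# `(1,0)`-form of its conjugate along the unitary group (R6c, per piece)

Topic `AlgebraicGeometry/ShimuraVarieties`; namespace `Literature.AlgebraicGeometry.ShimuraVarieties.UnitaryBallUniformisationDatum`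
(datum-dotted, as ★ R6b `UnitaryCurveConePullbackInjective`).  THEOREMS ONLY (no definition, no named fact, no instance, no `sorry`).
Cell `hodgecm-mathlib`, FLOOR-0 P5, crux `HLiu418`, line `F0_AlbCm`, sub-sub-line `F0_AlbCmS1Betti`, registered stub
`stub_S1_levelRealisation` (S1-R), leg R6c = the CLASS-LEVEL injectivity socket of the M5-rec design memo `DESIGN-M5rec` §1 (I)
(asked for as a separate file by the M5-glue author F0P5-p01 (g0), 2026-08-31).  HC_CM is proved only modulo the 7 printed citations until
rung 0 closes; nothing printed is asserted here.

For `D : UnitaryBallUniformisationDatum 1 X` (a compact ball-quotient CURVE `X`, `unif : 𝒞⁻(Hℂ) → X(ℂ)`), a Hodge model `A` of `X` with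
closed holomorphic `1`-forms (`hcl`), the holomorphic `(1,0)`-form of a class `c ∈ H¹(X(ℂ); ℂ)` is, in the currency of ★ `OneZeroFormOfClass`,
`ω c := A.oneFormOfClass _ hcl (Θ_X⁻¹ ((π^{1,0} c)|_{X^an}))`, and its CONE READ at an invertible matrix `m` (base vector `v₀`, direction `t₀`)
is `(ω c)_{ψ(m v₀)}(dψ_{m v₀}(m t₀))`, `ψ := (X^an ≃ X(ℂ))⁻¹ ∘ unif`.
* §1 `typeProj_oneZero_eq_zero_of_forall_coneRead_unitary_eq_zero` — if the cone read of `ω c` vanishes at every `g ∈ U(Hℂ)(ℂ)` then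
  `π^{1,0} c = 0`: ★ R6b `mform_eq_zero_of_forall_coneRead_unitary_eq_zero` (its local-injectivity hypothesis `hinj` is ★ R6a
  `exists_isOpen_unif_eq_unif_imp_smul`; `ω c` is `ℂ`-linear as a holomorphic form, ★ `isOfType_of_mem`) gives `ω c = 0`, and ★
  `oneZeroForm_eq_zero_iff` turns that into `π^{1,0} c = 0`;
* §2 **`eq_zero_of_forall_coneRead_unitary_eq_zero`** (R6c per piece) — if the cone reads of `ω c` AND of `ω c̄` vanish along `U(Hℂ)(ℂ)`
  then `c = 0` (§1 twice + ★ `eq_zero_of_typeProj_oneZero_eq_zero_of_conjClass`: `H¹ = H^{1,0} ⊕ H^{0,1}`, `H^{0,1} = conj H^{1,0}`);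
* §3 `eq_zero_of_forall_coneRead_archLocal_eq_zero` — the same with the group quantified in the adelic currency of the record curve:
  `Hℂ = J⋆^τ` for a CM field `L`, `τ : L → ℂ`, and the reads taken at the UNTWISTED matrices `ũ := embTwist_τ(u)` of the elements `u` of
  the archimedean factor `archLocal L 2 J⋆ (cmPlace L τ) = U(σ_{mk τ} J⋆)(ℂ)` (★ `archLocalOfEmb`: `u ↦ ũ` is onto `U(J⋆^τ)(ℂ)` since
  `embTwist` is an involution) — exactly the piece functions of ★ `UnitaryGroupAdelicLift.lift_eq_zero_iff`.
This is the injectivity of «class ↦ (cone function of its holomorphic part, cone function of the holomorphic part of its conjugate)» for the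
disc quotients of the record curve ([Borel1997, §5.14]: forms ↔ functions on the group; [VoisinHodgeI2002, §6.1.3 Cor. 6.14]: the Hodge
decomposition of `H¹` with `H^{0,1} = \overline{H^{1,0}}`).

## References
* [Borel1997] A. Borel, *Automorphic forms on SL₂(ℝ)* (1997), §5.13–§5.14.
* [VoisinHodgeI2002] C. Voisin, *Hodge Theory and Complex Algebraic Geometry I* (2002), §6.1.3 Cor. 6.14, §7.1.1 Cor. 7.6.
* [BorelJacquet1979] A. Borel, H. Jacquet, *Automorphic forms and automorphic representations*, Proc. Symp. Pure Math. 33.1 (1979), §4.1.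
-/

set_option autoImplicit false

noncomputable section

open Matrix Function NumberField
open scoped Manifold Topology
open Literature.Geometry.Kaehler (MForm holFormsInCharts isOfType_of_mem)
open Literature.NumberTheory.Transcendental
open Literature.AlgebraicGeometry.HodgeTheory
open Literature.AlgebraicGeometry.Motives (SchemeOver ComplexPoints AlgPoints)
open Literature.NumberTheory.Automorphic Literature.NumberTheory.Automorphic.UnitaryGroup

namespace Literature.AlgebraicGeometry.ShimuraVarieties

namespace UnitaryBallUniformisationDatum

section RankOne

variable {X : SchemeOver ℂ} (D : UnitaryBallUniformisationDatum 1 X) (A : HodgeModel 1 X) (hcl : A.HolFormsClosed 1)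

/-! ### §1 Vanishing cone read along `U(Hℂ)(ℂ)` ⇒ vanishing `(1,0)`-part -/

/-- **`π^{1,0} c = 0` if the cone read of `ω c` vanishes along the unitary group**: for `v₀` negative and `t₀ ∉ ℂ v₀`, if
`(ω c)_{ψ(g v₀)}(dψ_{g v₀}(g t₀)) = 0` for every `g ∈ GL₂(ℂ)` with `gᴴ Hℂ g = Hℂ`, then the `(1,0)`-component of `c` is zero (★ R6b with
★ R6a supplying local injectivity of `unif` modulo `ℂˣ`, then ★ `oneZeroForm_eq_zero_iff`). [cite: Borel1997, §5.14]
[cite: VoisinHodgeI2002, §7.1.1 Cor. 7.6] -/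
theorem typeProj_oneZero_eq_zero_of_forall_coneRead_unitary_eq_zero {v₀ t₀ : Fin 2 → ℂ} (hv₀ : v₀ ∈ D.cone)
    (hvt : ∀ c : ℂ, t₀ ≠ c • v₀) (c : complexBetti X 1)
    (h : ∀ g : GL (Fin 2) ℂ, (g : Matrix (Fin 2) (Fin 2) ℂ)ᴴ * D.Hℂ * (g : Matrix (Fin 2) (Fin 2) ℂ) = D.Hℂ →
      ((A.oneFormOfClass D.isSmoothProjective hcl
            ((A.complexification D.isSmoothProjective 1).symm
              (A.pullbackEquiv 1 (A.typeProj 1 ⟨(1, 0), Finset.HasAntidiagonal.mem_antidiagonal.2 rfl⟩ c)))) :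
          MForm 𝓘(ℝ, A.model) A.carrier ℂ 1)
        ((⇑A.isAnalytification.homeomorph.symm ∘ D.unif) ((g : Matrix (Fin 2) (Fin 2) ℂ) *ᵥ v₀))
        (fun _ ↦ mfderiv 𝓘(ℝ, Fin 2 → ℂ) 𝓘(ℝ, A.model) (⇑A.isAnalytification.homeomorph.symm ∘ D.unif)
          ((g : Matrix (Fin 2) (Fin 2) ℂ) *ᵥ v₀) ((g : Matrix (Fin 2) (Fin 2) ℂ) *ᵥ t₀)) = 0) :
    A.typeProj 1 ⟨(1, 0), Finset.HasAntidiagonal.mem_antidiagonal.2 rfl⟩ c = 0 := by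
  rw [← oneZeroForm_eq_zero_iff D.isSmoothProjective A hcl c]
  have hzero := D.mform_eq_zero_of_forall_coneRead_unitary_eq_zero A (isOfType_of_mem _).isComplexLinearForm
    (fun v hv => D.exists_isOpen_unif_eq_unif_imp_smul hv) hv₀ hvt h
  exact Subtype.ext hzero

/-! ### §2 R6c per piece: a class is detected by the cone reads of `ω c` and `ω c̄` -/

/-- **R6c (per piece).**  Let `D` uniformise the compact CURVE `X`, `A` a Hodge model with closed holomorphic `1`-forms, `v₀` negative and
`t₀ ∉ ℂ v₀`.  If for every `g ∈ GL₂(ℂ)` with `gᴴ Hℂ g = Hℂ` the cone reads at `(g v₀, g t₀)` of BOTH `ω c` and `ω c̄` (the `(1,0)`-forms of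
the class `c ∈ H¹(X(ℂ); ℂ)` and of its complex conjugate `c̄`) vanish, then `c = 0`: by §1, `π^{1,0} c = 0` and `π^{1,0} c̄ = 0`, and a
degree-one class with these two vanishings is zero (`H¹ = H^{1,0} ⊕ H^{0,1}`, `H^{0,1} = \overline{H^{1,0}}`, ★
`eq_zero_of_typeProj_oneZero_eq_zero_of_conjClass`). [cite: Borel1997, §5.14] [cite: VoisinHodgeI2002, §6.1.3 Cor. 6.14] -/
theorem eq_zero_of_forall_coneRead_unitary_eq_zero {v₀ t₀ : Fin 2 → ℂ} (hv₀ : v₀ ∈ D.cone)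
    (hvt : ∀ c : ℂ, t₀ ≠ c • v₀) (c : complexBetti X 1)
    (h10 : ∀ g : GL (Fin 2) ℂ, (g : Matrix (Fin 2) (Fin 2) ℂ)ᴴ * D.Hℂ * (g : Matrix (Fin 2) (Fin 2) ℂ) = D.Hℂ →
      ((A.oneFormOfClass D.isSmoothProjective hcl
            ((A.complexification D.isSmoothProjective 1).symm
              (A.pullbackEquiv 1 (A.typeProj 1 ⟨(1, 0), Finset.HasAntidiagonal.mem_antidiagonal.2 rfl⟩ c)))) :
          MForm 𝓘(ℝ, A.model) A.carrier ℂ 1)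
        ((⇑A.isAnalytification.homeomorph.symm ∘ D.unif) ((g : Matrix (Fin 2) (Fin 2) ℂ) *ᵥ v₀))
        (fun _ ↦ mfderiv 𝓘(ℝ, Fin 2 → ℂ) 𝓘(ℝ, A.model) (⇑A.isAnalytification.homeomorph.symm ∘ D.unif)
          ((g : Matrix (Fin 2) (Fin 2) ℂ) *ᵥ v₀) ((g : Matrix (Fin 2) (Fin 2) ℂ) *ᵥ t₀)) = 0)
    (h01 : ∀ g : GL (Fin 2) ℂ, (g : Matrix (Fin 2) (Fin 2) ℂ)ᴴ * D.Hℂ * (g : Matrix (Fin 2) (Fin 2) ℂ) = D.Hℂ →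
      ((A.oneFormOfClass D.isSmoothProjective hcl
            ((A.complexification D.isSmoothProjective 1).symm
              (A.pullbackEquiv 1 (A.typeProj 1 ⟨(1, 0), Finset.HasAntidiagonal.mem_antidiagonal.2 rfl⟩
                (conjClass (ComplexPoints X) 1 c))))) :
          MForm 𝓘(ℝ, A.model) A.carrier ℂ 1)
        ((⇑A.isAnalytification.homeomorph.symm ∘ D.unif) ((g : Matrix (Fin 2) (Fin 2) ℂ) *ᵥ v₀))
        (fun _ ↦ mfderiv 𝓘(ℝ, Fin 2 → ℂ) 𝓘(ℝ, A.model) (⇑A.isAnalytification.homeomorph.symm ∘ D.unif)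
          ((g : Matrix (Fin 2) (Fin 2) ℂ) *ᵥ v₀) ((g : Matrix (Fin 2) (Fin 2) ℂ) *ᵥ t₀)) = 0) :
    c = 0 :=
  eq_zero_of_typeProj_oneZero_eq_zero_of_conjClass D.isSmoothProjective A c
    (D.typeProj_oneZero_eq_zero_of_forall_coneRead_unitary_eq_zero A hcl hv₀ hvt c h10)
    (D.typeProj_oneZero_eq_zero_of_forall_coneRead_unitary_eq_zero A hcl hv₀ hvt _ h01)

/-! ### §3 The same with the group in the adelic currency: untwisted archimedean elements `ũ` -/

/-- **`u ↦ ũ := embTwist_τ(u)` is onto `U(J⋆^τ)(ℂ)`**: every `g ∈ GL₂(ℂ)` with `gᴴ J⋆^τ g = J⋆^τ` is the untwist of an element of the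
archimedean factor `archLocal L 2 J⋆ (cmPlace L τ) = U(σ_{mk τ} J⋆)(ℂ)` (★ `archLocalOfEmb`, `embTwist` being an involution).
[cite: BorelJacquet1979, §4.1] -/
theorem exists_archLocal_map_embTwist_eq {L : Type} [Field L] [NumberField L] [IsCMField L] (Jstar : Matrix (Fin 2) (Fin 2) L)
    (τ : L →+* ℂ) {g : GL (Fin 2) ℂ}
    (hg : (g : Matrix (Fin 2) (Fin 2) ℂ)ᴴ * Jstar.map τ * (g : Matrix (Fin 2) (Fin 2) ℂ) = Jstar.map τ) :
    ∃ u : archLocal L 2 Jstar (cmPlace L τ),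
      ((u : GL (Fin 2) ℂ) : Matrix (Fin 2) (Fin 2) ℂ).map (embTwist L τ) = (g : Matrix (Fin 2) (Fin 2) ℂ) := by
  have hg' : g ∈ unitaryGroupOfForm (starRingEnd ℂ) (Jstar.map τ) := by
    rw [mem_unitaryGroupOfForm_iff]
    have hT : ((g : Matrix (Fin 2) (Fin 2) ℂ).map (starRingEnd ℂ))ᵀ = (g : Matrix (Fin 2) (Fin 2) ℂ)ᴴ := by
      ext i j
      rfl
    rw [hT]
    exact hg
  refine ⟨archLocalOfEmb L 2 Jstar τ (isComplex_mk_of_isCMField L τ) ⟨g, hg'⟩, ?_⟩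
  rw [coe_archLocalOfEmb]
  ext i j
  simp only [Matrix.map_apply, Matrix.GeneralLinearGroup.map_apply, embTwist_embTwist]

/-- **R6c (per piece, adelic currency).**  With `Hℂ = J⋆^τ` (`L` a CM field, `τ : L → ℂ`), `v₀ ∈ 𝒞⁻(J⋆^τ)`, `t₀ ∉ ℂ v₀`: if the cone
reads of `ω c` and of `ω c̄` vanish at `(ũ v₀, ũ t₀)` for every `u` in the archimedean factor `U(σ_{mk τ} J⋆)(ℂ)`, `ũ := embTwist_τ(u)` —
i.e. the PIECE FUNCTIONS of the adelic lifts of the two cone-read families vanish (★ `lift_eq_zero_iff`) — then `c = 0` (§2, the untwist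
being onto `U(J⋆^τ)(ℂ)`). [cite: Borel1997, §5.14] [cite: VoisinHodgeI2002, §6.1.3 Cor. 6.14] [cite: BorelJacquet1979, §4.1] -/
theorem eq_zero_of_forall_coneRead_archLocal_eq_zero {L : Type} [Field L] [NumberField L] [IsCMField L]
    {Jstar : Matrix (Fin 2) (Fin 2) L} {τ : L →+* ℂ} (hH : D.Hℂ = Jstar.map τ)
    {v₀ t₀ : Fin 2 → ℂ} (hv₀ : v₀ ∈ negCone (Jstar.map τ)) (hvt : ∀ c : ℂ, t₀ ≠ c • v₀) (c : complexBetti X 1)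
    (h10 : ∀ u : archLocal L 2 Jstar (cmPlace L τ),
      ((A.oneFormOfClass D.isSmoothProjective hcl
            ((A.complexification D.isSmoothProjective 1).symm
              (A.pullbackEquiv 1 (A.typeProj 1 ⟨(1, 0), Finset.HasAntidiagonal.mem_antidiagonal.2 rfl⟩ c)))) :
          MForm 𝓘(ℝ, A.model) A.carrier ℂ 1)
        ((⇑A.isAnalytification.homeomorph.symm ∘ D.unif)
          ((((u : GL (Fin 2) ℂ) : Matrix (Fin 2) (Fin 2) ℂ).map (embTwist L τ)) *ᵥ v₀))
        (fun _ ↦ mfderiv 𝓘(ℝ, Fin 2 → ℂ) 𝓘(ℝ, A.model) (⇑A.isAnalytification.homeomorph.symm ∘ D.unif)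
          ((((u : GL (Fin 2) ℂ) : Matrix (Fin 2) (Fin 2) ℂ).map (embTwist L τ)) *ᵥ v₀)
          ((((u : GL (Fin 2) ℂ) : Matrix (Fin 2) (Fin 2) ℂ).map (embTwist L τ)) *ᵥ t₀)) = 0)
    (h01 : ∀ u : archLocal L 2 Jstar (cmPlace L τ),
      ((A.oneFormOfClass D.isSmoothProjective hcl
            ((A.complexification D.isSmoothProjective 1).symm
              (A.pullbackEquiv 1 (A.typeProj 1 ⟨(1, 0), Finset.HasAntidiagonal.mem_antidiagonal.2 rfl⟩
                (conjClass (ComplexPoints X) 1 c))))) :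
          MForm 𝓘(ℝ, A.model) A.carrier ℂ 1)
        ((⇑A.isAnalytification.homeomorph.symm ∘ D.unif)
          ((((u : GL (Fin 2) ℂ) : Matrix (Fin 2) (Fin 2) ℂ).map (embTwist L τ)) *ᵥ v₀))
        (fun _ ↦ mfderiv 𝓘(ℝ, Fin 2 → ℂ) 𝓘(ℝ, A.model) (⇑A.isAnalytification.homeomorph.symm ∘ D.unif)
          ((((u : GL (Fin 2) ℂ) : Matrix (Fin 2) (Fin 2) ℂ).map (embTwist L τ)) *ᵥ v₀)
          ((((u : GL (Fin 2) ℂ) : Matrix (Fin 2) (Fin 2) ℂ).map (embTwist L τ)) *ᵥ t₀)) = 0) :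
    c = 0 := by
  have hv₀' : v₀ ∈ D.cone := by
    show v₀ ∈ negCone D.Hℂ
    rw [hH]
    exact hv₀
  -- the cone reads as functions of the matrix, to transport along `ũ = g` under the binders of `mfderiv`
  let R : complexBetti X 1 → Matrix (Fin 2) (Fin 2) ℂ → ℂ := fun x m ↦
    ((A.oneFormOfClass D.isSmoothProjective hcl
          ((A.complexification D.isSmoothProjective 1).symm
            (A.pullbackEquiv 1 (A.typeProj 1 ⟨(1, 0), Finset.HasAntidiagonal.mem_antidiagonal.2 rfl⟩ x)))) :
        MForm 𝓘(ℝ, A.model) A.carrier ℂ 1)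
      ((⇑A.isAnalytification.homeomorph.symm ∘ D.unif) (m *ᵥ v₀))
      (fun _ ↦ mfderiv 𝓘(ℝ, Fin 2 → ℂ) 𝓘(ℝ, A.model) (⇑A.isAnalytification.homeomorph.symm ∘ D.unif) (m *ᵥ v₀) (m *ᵥ t₀))
  have key : ∀ x : complexBetti X 1,
      (∀ u : archLocal L 2 Jstar (cmPlace L τ), R x ((((u : GL (Fin 2) ℂ) : Matrix (Fin 2) (Fin 2) ℂ).map (embTwist L τ))) = 0) →
      ∀ g : GL (Fin 2) ℂ, (g : Matrix (Fin 2) (Fin 2) ℂ)ᴴ * D.Hℂ * (g : Matrix (Fin 2) (Fin 2) ℂ) = D.Hℂ →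
        R x (g : Matrix (Fin 2) (Fin 2) ℂ) = 0 := by
    intro x hx g hg
    rw [hH] at hg
    obtain ⟨u, hu⟩ := exists_archLocal_map_embTwist_eq Jstar τ hg
    exact ((congrArg (R x) hu).symm).trans (hx u)
  exact D.eq_zero_of_forall_coneRead_unitary_eq_zero A hcl hv₀' hvt c (key c h10) (key _ h01)

end RankOne

end UnitaryBallUniformisationDatum

end Literature.AlgebraicGeometry.ShimuraVarieties

end
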